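import Mathlib.RingTheory.MvPowerSeries.Basic
import Mathlib.Data.Finsupp.Weight
import HarnessLib

/-!
# Two letters: exponents and sums over an index type with exactly two named elements

`Literature/AlgebraicGeometry/Resolution/PointBlowupTwoLetters.lean` (HIRONAKA-L discharge lane, librarian
res-D-lib-2, dedupe hoist; DEF-FREE). The surface case of the point-blow-up / kangaroo files
(`PointBlowupFlag*.lean`, Hauser–Perlega's "parameters `x, y`" of a two-dimensional regular local ring,
monomials `x^i y^j` [cite: HauserPerlega2024, §4 p. 779]) is written over an arbitrary index type `σ` with
two named letters

  `{x y : σ} (hxy : x ≠ y) (hσ : ∀ l, l = x ∨ l = y)`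

rather than over `Fin 2`, so that the general-`σ` definitions (`chartExponent`, `cleanSeries`, weights,
flags) apply verbatim. Every such file re-derived privately the same bookkeeping (librarian census
2026-08-27: `single_add_single_apply_left/right` ×11 files, `sum_univ_two` ×10, `finsupp_eq_two` ×8,
`finsupp_le_iff_two` ×4, `univ_eq_pair` ×3, `forall_dvd_iff_two` ×3, `prod_univ_two` ×3, `weight_two`, …,
under the names `s_l`, `sa_l`, `ssa_l`, `t_l`, `u_l`, `fe2`, `s2`, …). This file states them ONCE:

* letters: `eq_of_ne_left_of_two`, `eq_of_ne_right_of_two`, `forall_iff_of_two`, `exists_iff_of_two`,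
  `univ_eq_pair_of_two`, `card_eq_two_of_two`;
* sums and products over all letters: `sum_eq_add_of_two`, `prod_eq_mul_of_two`;
* exponents `σ →₀ M`: `single_add_single_apply_left`, `single_add_single_apply_right`,
  `finsupp_ext_of_two`, `finsupp_eq_iff_of_two`, `support_subset_pair_of_two`,
  `finsupp_le_iff_of_two`, `forall_dvd_iff_of_two`, `weight_eq_of_two`, `degree_eq_add_of_two`.

Already public elsewhere (not restated): `HauserPerlega2024.finsupp_eq_single_add_single`
(`d = d x • e_x + d y • e_y`), `HauserPerlega2024.degree_eq_two`, `HauserPerlega2024.chartExponent_two`,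
`pkgWeight_eq_two` (`PointBlowupFlagTranslatedStep.lean`, `PointBlowupFlagKangarooCase.lean`).
Nothing here is a statement about resolution of singularities.
-/

open Finset

open scoped BigOperators

namespace Literature.AlgebraicGeometry.Resolution

variable {σ : Type*} {x y : σ}

/-! ## The two letters -/

/-- With two letters, a letter different from `x` is `y`. [cite: HauserPerlega2024, §4 p. 779 (the parameters x, y)] -/
theorem eq_of_ne_left_of_two (hσ : ∀ l, l = x ∨ l = y) {l : σ} (h : l ≠ x) : l = y :=
  (hσ l).resolve_left h

/-- With two letters, a letter different from `y` is `x`. [cite: HauserPerlega2024, §4 p. 779 (the parameters x, y)] -/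
theorem eq_of_ne_right_of_two (hσ : ∀ l, l = x ∨ l = y) {l : σ} (h : l ≠ y) : l = x :=
  (hσ l).resolve_right h

/-- With two letters, «for every letter» is the conjunction at `x` and `y`. [cite: HauserPerlega2024, §4 p. 779 (the parameters x, y)] -/
theorem forall_iff_of_two (hσ : ∀ l, l = x ∨ l = y) {P : σ → Prop} : (∀ l, P l) ↔ P x ∧ P y :=
  ⟨fun h => ⟨h x, h y⟩, fun h l => by rcases hσ l with rfl | rfl; exacts [h.1, h.2]⟩

/-- With two letters, «for some letter» is the disjunction at `x` and `y`. [cite: HauserPerlega2024, §4 p. 779 (the parameters x, y)] -/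
theorem exists_iff_of_two (hσ : ∀ l, l = x ∨ l = y) {P : σ → Prop} : (∃ l, P l) ↔ P x ∨ P y :=
  ⟨fun ⟨l, hl⟩ => by rcases hσ l with rfl | rfl; exacts [Or.inl hl, Or.inr hl],
    fun h => h.elim (fun h => ⟨x, h⟩) fun h => ⟨y, h⟩⟩

/-- With two letters, `univ = {x, y}`. [cite: HauserPerlega2024, §4 p. 779 (the parameters x, y)] -/
theorem univ_eq_pair_of_two [Fintype σ] [DecidableEq σ] (hσ : ∀ l, l = x ∨ l = y) :
    (Finset.univ : Finset σ) = {x, y} := by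
  ext l
  simp only [Finset.mem_univ, Finset.mem_insert, Finset.mem_singleton, true_iff]
  exact hσ l

/-- With two distinct letters, `σ` has exactly two elements. [cite: HauserPerlega2024, §4 p. 779 (the parameters x, y)] -/
theorem card_eq_two_of_two [Fintype σ] (hxy : x ≠ y) (hσ : ∀ l, l = x ∨ l = y) : Fintype.card σ = 2 := by
  classical
  rw [← Finset.card_univ, univ_eq_pair_of_two hσ, Finset.card_pair hxy]

/-! ## Sums and products over all letters -/

/-- With two distinct letters, a sum over all letters has two terms. [cite: HauserPerlega2024, §4 p. 779 (the parameters x, y)] -/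
theorem sum_eq_add_of_two [Fintype σ] {M : Type*} [AddCommMonoid M] (hxy : x ≠ y)
    (hσ : ∀ l, l = x ∨ l = y) (f : σ → M) : ∑ l, f l = f x + f y := by
  classical
  rw [univ_eq_pair_of_two hσ, Finset.sum_pair hxy]

/-- With two distinct letters, a product over all letters has two factors. [cite: HauserPerlega2024, §4 p. 779 (the parameters x, y)] -/
theorem prod_eq_mul_of_two [Fintype σ] {M : Type*} [CommMonoid M] (hxy : x ≠ y)
    (hσ : ∀ l, l = x ∨ l = y) (f : σ → M) : ∏ l, f l = f x * f y := by
  classical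
  rw [univ_eq_pair_of_two hσ, Finset.prod_pair hxy]

/-! ## Exponents `σ →₀ M` with two letters -/

section Finsupp

variable {M : Type*}

/-- Evaluation of `a·e_x + b·e_y` at `x` (any two distinct letters `x ≠ y` of any index type).
[cite: HauserPerlega2024, §4 p. 779 (monomials x^i y^j)] -/
theorem single_add_single_apply_left [AddZeroClass M] (hxy : x ≠ y) (a b : M) :
    (Finsupp.single x a + Finsupp.single y b) x = a := by
  rw [Finsupp.add_apply, Finsupp.single_eq_same, Finsupp.single_eq_of_ne hxy, add_zero]

/-- Evaluation of `a·e_x + b·e_y` at `y`. [cite: HauserPerlega2024, §4 p. 779 (monomials x^i y^j)] -/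
theorem single_add_single_apply_right [AddZeroClass M] (hxy : x ≠ y) (a b : M) :
    (Finsupp.single x a + Finsupp.single y b) y = b := by
  rw [Finsupp.add_apply, Finsupp.single_eq_same, Finsupp.single_eq_of_ne (Ne.symm hxy), zero_add]

/-- With two letters an exponent is determined by its two entries. [cite: HauserPerlega2024, §4 p. 779 (monomials x^i y^j)] -/
theorem finsupp_ext_of_two [Zero M] (hσ : ∀ l, l = x ∨ l = y) {d d' : σ →₀ M} (hx : d x = d' x)
    (hy : d y = d' y) : d = d' := by
  ext l
  rcases hσ l with rfl | rfl
  exacts [hx, hy]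

/-- With two letters two exponents are equal iff their two entries are. [cite: HauserPerlega2024, §4 p. 779 (monomials x^i y^j)] -/
theorem finsupp_eq_iff_of_two [Zero M] (hσ : ∀ l, l = x ∨ l = y) {d d' : σ →₀ M} :
    d = d' ↔ d x = d' x ∧ d y = d' y :=
  ⟨fun h => by subst h; exact ⟨rfl, rfl⟩, fun h => finsupp_ext_of_two hσ h.1 h.2⟩

/-- With two letters every exponent is supported in `{x, y}`. [cite: HauserPerlega2024, §4 p. 779 (monomials x^i y^j)] -/
theorem support_subset_pair_of_two [Zero M] [DecidableEq σ] (hσ : ∀ l, l = x ∨ l = y) (d : σ →₀ M) :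
    d.support ⊆ {x, y} := fun l _ => by
  rw [Finset.mem_insert, Finset.mem_singleton]
  exact hσ l

/-- With two letters, comparison of exponents is comparison of the two entries.
[cite: HauserPerlega2024, §4 p. 779 (monomials x^i y^j)] -/
theorem finsupp_le_iff_of_two (hσ : ∀ l, l = x ∨ l = y) {f g : σ →₀ ℕ} : f ≤ g ↔ f x ≤ g x ∧ f y ≤ g y :=
  ⟨fun h => ⟨h x, h y⟩, fun h l => by rcases hσ l with rfl | rfl; exacts [h.1, h.2]⟩

/-- With two letters, «every entry is divisible by `q`» (the `q`-th-power test of the cleaning) is the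
conjunction of the two divisibilities. [cite: HauserPerlega2024, §4 p. 779 (monomials x^i y^j)] -/
theorem forall_dvd_iff_of_two (hσ : ∀ l, l = x ∨ l = y) (q : ℕ) (d : σ →₀ ℕ) :
    (∀ l, q ∣ d l) ↔ q ∣ d x ∧ q ∣ d y :=
  forall_iff_of_two hσ

/-- With two distinct letters, a weight is `m_x w_x + m_y w_y`. [cite: HauserPerlega2024, §4 p. 781 (the weighted order ω)] -/
theorem weight_eq_of_two [Fintype σ] (hxy : x ≠ y) (hσ : ∀ l, l = x ∨ l = y) (w : σ → ℕ) (m : σ →₀ ℕ) :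
    Finsupp.weight w m = m x * w x + m y * w y := by
  rw [Finsupp.weight_apply, Finsupp.sum_fintype _ _ (fun i => by simp), sum_eq_add_of_two hxy hσ]
  simp only [smul_eq_mul]

/-- With two distinct letters, the degree of an exponent is the sum of its two entries (the `Fintype`-free
form; `HauserPerlega2024.degree_eq_two` is the same identity under `[Fintype σ] [DecidableEq σ]`).
[cite: HauserPerlega2024, §4 p. 781 (the degree i + j)] -/
theorem degree_eq_add_of_two (hxy : x ≠ y) (hσ : ∀ l, l = x ∨ l = y) (d : σ →₀ ℕ) :
    d.degree = d x + d y := by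
  classical
  rw [Finsupp.degree_apply]
  rw [Finset.sum_subset (support_subset_pair_of_two hσ d)
    (fun l _ hl => Finsupp.notMem_support_iff.mp hl), Finset.sum_pair hxy]

end Finsupp

end Literature.AlgebraicGeometry.Resolution
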